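import Summits.QuantumFields.YangMills.Theorems.BalabanUVNodesN11SpaceTruncationBorelB

/-!
# DAG node N11 — door (d4) AT THE CHARGED INDICES: the background proviso of the no-expansion 𝐓-step is read ONLY at indices whose slot of record is
# non-zero; charged indices are print-separated, so p591971's print-void residue `hNS` at non-separated indices is ELIMINATED

HEADER — WORK-UNIT METADATA.  Cell `pub-ymgap`, YM-PLAN Track A (HUMAN RULING D-0062), seat `pub-ymgap-dag-n11-d` (g12; R134 fan-out seat N11 [B14], strategy s2),
route `BalabanUVNodes`, item K1⁷ `StabilityBAtRecordR13SepCoPH` = stmt-QuantumFields-20542 (helper, `--kind proof --supports 20542 --as helper`, count-neutral).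
[III] = [Balaban1988Convergent], [6] = [Balaban1985RegularSpaces].  Over this seat's p589738 `…N11SpaceTruncation` (★★★ `exists_local_witness_clause_succ_of_sLaw₁₃CoPH_of_bgRead`,
`sect2Slot_spaceTrunc_eq`), p591695 `…N11SpaceTruncationBorelB` (★★★★ the witness-first face, `sect2Slot_spaceTruncR_eq`), p591971 `…N11SpaceTruncationAtSepIndices`
(the three-way split `bg` + hJ + hNS), dag-n11-e g6's `Literature/…/B14SeparationOfRecord` (★★ `seqSeparated_of_slotsOfRecord₁₃_ne_zero_of_M₁_le_M`: every sequence CHARGED by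
`ρ_k` of record is `Sect2.SeqSeparated`), def-T's `Record13SepCoPH` (row `Provisos₁₃SepCoPH.bg`, `suppOfRecord₁₃SepCoP`, `PartCompat₁₃`), def-R's `BgProvisoΛ`.

WHY THIS FILE (one displayed hypothesis REMOVED, not re-shuffled).  p591971 keyed def-R's background proviso over the READING support of the 𝐓-step at EVERY index
`s₀ : SeqOfRecord … k`, and therefore had to display, at NON-separated indices (where the record's separated support is EMPTY), the print-void residue `hNS`.  But the
per-index clause of def-T's `HasSect2FormAtZS` is `slot s₀ = 0 ∨ (a.e. identity on the χ-support)`: at an index whose slot of record VANISHES the space-truncated witness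
satisfies the clause by the zero branch, and the background is never read there.  So the proviso is needed only at CHARGED indices (`slotsOfRecord … k s₀ ≠ 0`), and
dag-n11-e g6 proved that every charged index is print-separated (`B14SeparationOfRecord` §6: the index map (3.5)∕(3.20) keeps three 𝐃-layers; under the grid comparison
`0 < M₁ ≤ M`, automatic at K0a's witnesses `M₁ = M = 1`).  Hence the no-expansion 𝐓-step is keyed on the record row `bg` + the junction hJ AT CHARGED SEPARATED INDICES —
`hNS` is GONE.  (The 𝐓-step clause at a child `s` reads the level-`k` form clause at `s.init` only; no background proviso enters there.)

WHAT THIS FILE PROVES (0 `sorry`, 0 `def`).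
§1 generic transport lemmas, CHARGED form: `hasSect2FormAtZS_spaceTrunc_of_charged` ∕ `hasSect2FormAtZS_spaceTruncR_of_charged` — p589738's ∕ p591695's
   `hasSect2FormAtZS_spaceTrunc(R)` with the background hypothesis demanded only at indices with `slot s₀ ≠ 0`.
§2 at the record: ★★★ `exists_local_witness_clause_succ_of_sLaw₁₃CoPH_of_bgReadCharged` and ★★★★ `exists_local_witness_clause_succ_of_hasSect2FormAtZS_of_borelB_of_bgReadCharged`
   — conclusions VERBATIM p589738 ∕ p591695, the proviso read over the CHARGED reading support `{Wc | slot_k(s₀) ≠ 0 ∧ χ_k(s₀)(Wc k) ≠ 0 ∧ lower-scale regularity}`.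
The separated-indices edition (record row `bg` + junction at charged — hence separated — indices, NO residue `hNS`, under `0 < θ.ν.M₁ ≤ θ.τ9.M`) is the sibling
file `…N11SpaceTruncationChargedSep` (kept apart for the 400-line bound).

HONEST FRAMING.  Helper lane of K1⁷; bookkeeping over tree theorems; nothing of Bałaban's is asserted; the junction hJ (def-R's R-half of [RFACE-11d]: top-scale
regularity and the (7)-data from `χ_k ≠ 0`) REMAINS a displayed hypothesis, now asked only at charged separated indices.  N11 NOT discharged; K1⁷ NOT closed; counts
unmoved (typed 28∕28 · discharged 5∕27).  One finite four-torus programme at fixed `ε = L^{−K}` — NOT ℝ⁴, NOT OS, NOT a mass gap, NOT Clay.  No `sorry`, `axiom`,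
`def`, `instance`, `notation`.  Sources (SHAPE only): [III] (2.1) p.254, (2.10) p.256, (2.17)–(2.18) p.257, (2.28) p.259, Thm 1 p.262, (3.5) p.265, (3.24)–(3.25) p.270;
[6] (1.3)–(1.6) p.77.
-/

noncomputable section

open MeasureTheory
open scoped BigOperators ENNReal NNReal Matrix.Norms.L2Operator

universe u

namespace Summit.QuantumFields.YangMills.Theorems.BalabanUVNodesN11SpaceTruncationCharged

open Literature.MathematicalPhysics.QuantumFieldTheory.Balaban1983to89 T4Continuum T4NestedCovariance Node00 Node00.Tk DagBinding
open B15DeterminingSets B8Eq17ClassAkV1 Step B14.Eq227LocalizedTerms B14.Eq225Concrete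
open BalabanUVNodesN11FluctTruncationDefs (IsFluctLocal truncTermValues isFluctLocal_truncTermValues lawsRT_truncTermValues
  action23_sect2ActionDataOfRecord_congr_fluct_of_isFluctLocal)
open BalabanUVNodesN11OpenLocusTruncationDefs BalabanUVNodesN11SpaceTruncationDefs BalabanUVNodesN11SpaceTruncationBorelBDefs BalabanUVNodesN11TkReadingSupport
open BalabanUVNodesN11FluctTruncation (sLaw₁₃CoPH_iff_exists_local hasSect2FormAtZS_truncTermValues)
open BalabanUVNodesN11NoExpansionOldBranchGraph (clause_succ_CoPH_of_Omega_empty_of_pinChi_of_oldBranch_of_clause_of_graph)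
open BalabanUVNodesN11OldBranchIntegrableOfDominated (integrable_oldBranch_of_dominated)
open BalabanUVNodesN11OperandRowsOfTermRows (measurable_sect2Operand_of_termRows exists_bound_sect2Operand_of_termBounds)
open BalabanUVNodesN11BackgroundCoPMeasurable (measurable_UbgOfRecord₁₃CoP)
open BalabanUVNodesN11SpaceTruncation (sect2Slot_spaceTrunc_eq)
open BalabanUVNodesN11SpaceTruncationBorelB (sect2Slot_spaceTruncR_eq)

/-! ## §1  The transport lemmas in CHARGED form: the background is read only at indices whose slot is non-zero -/

section Slot

variable {F : T4Family} {N : ℕ} [NeZero N] {V : Type} [NormedAddCommGroup V] [InnerProductSpace ℝ V] [FiniteDimensional ℝ V] [MeasurableSpace V] [BorelSpace V]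
variable {𝔸 : Type*} [NormedRing 𝔸] [NormedAlgebra ℂ 𝔸] [CompleteSpace 𝔸]
variable {ν : Stage7Numerics} {M : ℕ} {g : ℕ → ℝ} {K : ℕ}

/-- **★ THE §2 FORM PREDICATE TRANSPORTS TO THE SPACE-TRUNCATED WITNESS FAMILY, the background hypothesis read ONLY AT CHARGED INDICES** (`slot s₀ ≠ 0`): at an
uncharged index the per-index clause `slot s₀ = 0 ∨ …` holds by its zero branch; at a charged one p589738's `sect2Slot_spaceTrunc_eq` applies as before.
[cite: Balaban1988Convergent, (2.17)–(2.18) p.257, Thm 1 p.262, (2.28) p.259, (2.10) p.256] -/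
theorem hasSect2FormAtZS_spaceTrunc_of_charged (Sg : Sect2.Setting 𝔸 (SU N)) {k n₀ : ℕ} (hk : k ≤ n₀) (Rz : SeqOfRecord F ν M g K k → Sect2.Residual (F.P K) 𝔸)
    (W : SeqOfRecord F ν M g K k → TkWeights F N V K) (U : SeqOfRecord F ν M g K k → BgMap F N K)
    (slot : SeqOfRecord F ν M g K k → Density (F.P K) k (SU N))
    (Reg : SeqOfRecord F ν M g K k → (j : ℕ) → GaugeField (F.P K) j (SU N) → Prop)
    (hζ : ∀ s₀ j, j < k → ∀ ω : MultiCfg (F.P K) (SU N) V, (W s₀).ζ j (s₀.Ω (j + 1))ᶜ ω ≠ 0 → Reg s₀ j (ω j).1)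
    (hg : ∀ j, 1 ≤ j → j ≤ k → 0 ≤ Sg.flow.g (j - 1) ∧ Sg.flow.g (j - 1) ≤ Sg.lf.γ)
    (h1 : ∀ s₀ j, 1 ≤ j → j ≤ k → ∀ X : (Sect2.domSys (F.P K) M j).Dom,
      Sect2.ofBackgroundC Sg.ι (1 : GaugeField (F.P K) 0 (SU N)) ∈
        Sect2.spaceI Sg (Rz s₀) M j (Sect2.domSites (F.P K) M j X) (Sg.lf.alpha0 (Sg.flow.g j)) (Sg.lf.alpha1 (Sg.flow.g j)))
    (hbg : ∀ s₀, slot s₀ ≠ 0 → ∀ Wc : MSField (F.P K) (SU N), chiSeqOfRecord F N ν M g K k s₀ (Wc k) ≠ 0 → (∀ j, j < k → Reg s₀ j (Wc j)) →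
      ∀ j, 1 ≤ j → j ≤ k → ∀ X : (Sect2.domSys (F.P K) M j).Dom,
      (Sect2.domSites (F.P K) M j X ⊆ s₀.Λ j →
        Sect2.ofBackgroundC Sg.ι (U s₀ Wc) ∈ Sect2.spaceI Sg (Rz s₀) M j (Sect2.domSites (F.P K) M j X) (Sg.lf.alpha0 (Sg.flow.g j)) (Sg.lf.alpha1 (Sg.flow.g j))) ∧
      (Sect2.admB (F.P K) ν M g s₀.Ω s₀.Λ j (Sect2.domSites (F.P K) M j X) = true →
        Sect2.ofBackgroundC Sg.ι (U s₀ Wc) ∈ Sect2.spaceMS Sg (Rz s₀) M j (Sect2.domSites (F.P K) M j X) s₀.Ω))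
    {t : SeqOfRecord F ν M g K k → Sect2.TermValues (F.P K) 𝔸 V M} {Ek : SeqOfRecord F ν M g K k → ℝ}
    (h : HasSect2FormAtZS F N V K Sg k Rz W U (fun s₀ t₀ => Sect2.LawsRT (sect2TowerOfRecord F N V K Sg (Rz s₀) s₀ t₀) Sg.lf k) slot t Ek) :
    HasSect2FormAtZS F N V K Sg k Rz W U (fun s₀ t₀ => Sect2.LawsRT (sect2TowerOfRecord F N V K Sg (Rz s₀) s₀ t₀) Sg.lf k) slot
      (fun s₀ => spaceTrunc Sg n₀ (t s₀)) Ek := by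
  refine ⟨universalE_spaceTrunc h.1 Sg n₀, fun s₀ => ⟨lawsRT_spaceTrunc Sg (Rz s₀) s₀.Ω (t s₀) hk (h.2 s₀).1, ?_⟩⟩
  by_cases hs : slot s₀ = 0
  · exact Or.inl hs
  rcases (h.2 s₀).2 with h0 | hae
  · exact Or.inl h0
  · refine Or.inr ?_
    filter_upwards [hae] with Vn hVn hχ
    rw [hVn hχ]
    exact (sect2Slot_spaceTrunc_eq Sg (Rz s₀) (W s₀) hk s₀ (Reg s₀) (hζ s₀) (t s₀) (Ek s₀) (U s₀) Vn (h.2 s₀).1 hg (h1 s₀)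
      (fun Wc hW hR => hbg s₀ hs Wc (by rw [hW]; exact hχ) hR)).symm

/-- **★ The same for the RETRACTED family `spaceTruncR`** (p591695's `hasSect2FormAtZS_spaceTruncR`, background read only at charged indices).
[cite: Balaban1988Convergent, (2.17)–(2.18) p.257, Thm 1 p.262, (2.28) p.259, (2.10) p.256] -/
theorem hasSect2FormAtZS_spaceTruncR_of_charged (Sg : Sect2.Setting 𝔸 (SU N)) {k n₀ : ℕ} (hk : k ≤ n₀) (Rz : SeqOfRecord F ν M g K k → Sect2.Residual (F.P K) 𝔸)
    (W : SeqOfRecord F ν M g K k → TkWeights F N V K) (U : SeqOfRecord F ν M g K k → BgMap F N K)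
    (slot : SeqOfRecord F ν M g K k → Density (F.P K) k (SU N))
    (Reg : SeqOfRecord F ν M g K k → (j : ℕ) → GaugeField (F.P K) j (SU N) → Prop)
    (hζ : ∀ s₀ j, j < k → ∀ ω : MultiCfg (F.P K) (SU N) V, (W s₀).ζ j (s₀.Ω (j + 1))ᶜ ω ≠ 0 → Reg s₀ j (ω j).1)
    (hg : ∀ j, 1 ≤ j → j ≤ k → 0 ≤ Sg.flow.g (j - 1) ∧ Sg.flow.g (j - 1) ≤ Sg.lf.γ)
    (h1 : ∀ s₀ j, 1 ≤ j → j ≤ k → ∀ X : (Sect2.domSys (F.P K) M j).Dom,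
      Sect2.ofBackgroundC Sg.ι (1 : GaugeField (F.P K) 0 (SU N)) ∈
        Sect2.spaceI Sg (Rz s₀) M j (Sect2.domSites (F.P K) M j X) (Sg.lf.alpha0 (Sg.flow.g j)) (Sg.lf.alpha1 (Sg.flow.g j)))
    (hbg : ∀ s₀, slot s₀ ≠ 0 → ∀ Wc : MSField (F.P K) (SU N), chiSeqOfRecord F N ν M g K k s₀ (Wc k) ≠ 0 → (∀ j, j < k → Reg s₀ j (Wc j)) →
      ∀ j, 1 ≤ j → j ≤ k → ∀ X : (Sect2.domSys (F.P K) M j).Dom,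
      (Sect2.domSites (F.P K) M j X ⊆ s₀.Λ j →
        Sect2.ofBackgroundC Sg.ι (U s₀ Wc) ∈ Sect2.spaceI Sg (Rz s₀) M j (Sect2.domSites (F.P K) M j X) (Sg.lf.alpha0 (Sg.flow.g j)) (Sg.lf.alpha1 (Sg.flow.g j))) ∧
      (Sect2.admB (F.P K) ν M g s₀.Ω s₀.Λ j (Sect2.domSites (F.P K) M j X) = true →
        Sect2.ofBackgroundC Sg.ι (U s₀ Wc) ∈ Sect2.spaceMS Sg (Rz s₀) M j (Sect2.domSites (F.P K) M j X) s₀.Ω))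
    {t : SeqOfRecord F ν M g K k → Sect2.TermValues (F.P K) 𝔸 V M} {Ek : SeqOfRecord F ν M g K k → ℝ}
    (h : HasSect2FormAtZS F N V K Sg k Rz W U (fun s₀ t₀ => Sect2.LawsRT (sect2TowerOfRecord F N V K Sg (Rz s₀) s₀ t₀) Sg.lf k) slot t Ek) :
    HasSect2FormAtZS F N V K Sg k Rz W U (fun s₀ t₀ => Sect2.LawsRT (sect2TowerOfRecord F N V K Sg (Rz s₀) s₀ t₀) Sg.lf k) slot
      (fun s₀ => spaceTruncR Sg n₀ (t s₀)) Ek := by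
  refine ⟨universalE_spaceTruncR h.1 Sg n₀, fun s₀ => ⟨lawsRT_spaceTruncR Sg (Rz s₀) s₀.Ω (t s₀) hk (h.2 s₀).1, ?_⟩⟩
  by_cases hs : slot s₀ = 0
  · exact Or.inl hs
  rcases (h.2 s₀).2 with h0 | hae
  · exact Or.inl h0
  · refine Or.inr ?_
    filter_upwards [hae] with Vn hVn hχ
    rw [hVn hχ]
    exact (sect2Slot_spaceTruncR_eq Sg (Rz s₀) (W s₀) hk s₀ (Reg s₀) (hζ s₀) (t s₀) (Ek s₀) (U s₀) Vn (h.2 s₀).1 hg (h1 s₀)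
      (fun Wc hW hR => hbg s₀ hs Wc (by rw [hW]; exact hχ) hR)).symm

end Slot

/-! ## §2  AT THE RECORD: the two no-expansion 𝐓-step faces with the background proviso over the CHARGED reading support -/

section Record

variable {F : T4Family} {N : ℕ} [NeZero N]

variable (θ : Stage13HParams F N) (p : B12.RunParams)

/-- **★★★ p589738's ★★★ WITH THE BACKGROUND PROVISO READ AT CHARGED INDICES ONLY.**  As `…SpaceTruncation.exists_local_witness_clause_succ_of_sLaw₁₃CoPH_of_bgRead`,
conclusion VERBATIM, with def-R's `BgProvisoΛ` at the Co-class background asked over the CHARGED reading support `{Wc | slot_k(s₀) ≠ 0 ∧ χ_k(s₀)(Wc k) ≠ 0 ∧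
scales j < k regular at cR·ε_j on Γr s₀ j (Ω^c_{j+1})}` — at an index whose slot of `ρ_k` of record vanishes nothing is read.
[cite: Balaban1988Convergent, Theorem p.245, Thm 1 p.262, (2.7) p.255, (2.10) p.256, (2.18) p.257, (2.20)–(2.28) pp.258–259, (2.31) p.260, (2.41)–(2.42) p.261, (3.24)–(3.25) p.270; Balaban1989LargeFieldI, (0.2)–(0.3) p.176] -/
theorem exists_local_witness_clause_succ_of_sLaw₁₃CoPH_of_bgReadCharged (h : θ.Provisos₁₃CoPH F N) (hU : θ.ZhUnity F N) (hθ : θ.Admissible F N)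
    (hpos : θ.s2.Pos) {k : ℕ} (hk : k < p.K) (hM : 1 ≤ θ.τ9.M) (hw : Step.InInterval θ.γ k (gOfRecord₁₃ F N θ.toStage13Params p))
    (cR : ℝ) (Γr : SeqOfRecord F θ.ν θ.τ9.M (gOfRecord₁₃ F N θ.toStage13Params p) p.K k → ℕ → Set (Site (F.P p.K) 0) → Set (Site (F.P p.K) 0))
    (hreg : ∀ s₀, (θ.zhAt p s₀).RegOn F N (FluctV N) θ.ν cR p (gOfRecord₁₃ F N θ.toStage13Params p) (Γr s₀))
    (hbg : BgProvisoΛ F N p.K (settingOfRecord₁₃ F N θ.toStage13Params p) (θ.Rz p.K) θ.τ9.M k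
      (fun s₀ => {Wc | slotsOfRecord F N θ.ν θ.τ9 (EOfRecord₁₃ F N θ.toStage13Params) (wOfRecord₉ F N θ.toStage9Params) θ.ppSel p
          (gOfRecord₁₃ F N θ.toStage13Params p) k s₀ ≠ 0 ∧
        chiSeqOfRecord F N θ.ν θ.τ9.M (gOfRecord₁₃ F N θ.toStage13Params p) p.K k s₀ (Wc k) ≠ 0 ∧
        ∀ j, j < k → PlaqSmallOn (plaqsOf (pts j (Γr s₀ j (s₀.Ω (j + 1))ᶜ))) (cR * epsOfRecord θ.ν (gOfRecord₁₃ F N θ.toStage13Params p) j) (Wc j)})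
      (UbgOfRecord₁₃CoP F N θ.toStage13Params p k))
    (hS : SLaw₁₃CoPH F N θ p k) :
    ∃ (t : SeqOfRecord F θ.ν θ.τ9.M (gOfRecord₁₃ F N θ.toStage13Params p) p.K k → Sect2.TermValues (F.P p.K) (MatA N) (FluctV N) θ.τ9.M)
      (Ek : SeqOfRecord F θ.ν θ.τ9.M (gOfRecord₁₃ F N θ.toStage13Params p) p.K k → ℝ),
      HasSect2FormAtZS F N (FluctV N) p.K (settingOfRecord₁₃ F N θ.toStage13Params p) k (θ.rzAt p) (WtOfRecord₁₃H F N θ p)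
          (UbgOfRecord₁₃CoP F N θ.toStage13Params p k)
          (fun s₀ t₀ => Sect2.LawsRT (sect2TowerOfRecord F N (FluctV N) p.K (settingOfRecord₁₃ F N θ.toStage13Params p) (θ.rzAt p s₀) s₀ t₀)
            (settingOfRecord₁₃ F N θ.toStage13Params p).lf k)
          (slotsOfRecord F N θ.ν θ.τ9 (EOfRecord₁₃ F N θ.toStage13Params) (wOfRecord₉ F N θ.toStage9Params) θ.ppSel p
            (gOfRecord₁₃ F N θ.toStage13Params p) k) t Ek ∧
      (∀ s₀, IsFluctLocal k (t s₀)) ∧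
      ∀ (s : SeqOfRecord F θ.ν θ.τ9.M (gOfRecord₁₃ F N θ.toStage13Params p) p.K (k + 1)), s.Ω (k + 1) = ∅ →
        -- (P) prefix agreement below `k`
        (∀ j, j < k → (θ.zhAt p s).ζ0 j = (θ.zhAt p s.init).ζ0 j ∧ (θ.zhAt p s).quad j = (θ.zhAt p s.init).quad j) →
        -- (V) the generation-`k` pin with the old front factor
        (∀ (V' : GaugeField (F.P p.K) (k + 1) (SU N)) (U₀ : GaugeField (F.P p.K) k (SU N)),
          (θ.zhAt p s).ζ0 k Set.univ (pairCfgAt (V := FluctV N) k V' U₀) =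
            chiSeqOfRecord F N θ.ν θ.τ9.M (gOfRecord₁₃ F N θ.toStage13Params p) p.K k s.init U₀ *
              wOfRecord₉ F N θ.toStage9Params p (gOfRecord₁₃ F N θ.toStage13Params p) k s U₀ ((avOfRecord F N p.K k).avg U₀)) →
        -- `quad_k(∅) = 0` on the two-scale configurations
        (∀ (V' : GaugeField (F.P p.K) (k + 1) (SU N)) (U₀ : GaugeField (F.P p.K) k (SU N)), (θ.zhAt p s).quad k ∅ (pairCfgAt (V := FluctV N) k V' U₀) = 0) →
        -- `k`-locality of `quad_j(Λ_{j+1})`, `j < k`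
        (∀ j, j < k → ∀ ω ω' : MultiCfg (F.P p.K) (SU N) (FluctV N), (∀ i, i ≤ k → ω i = ω' i) →
          (θ.zhAt p s).quad j (s.init.Λ (j + 1)) ω = (θ.zhAt p s).quad j (s.init.Λ (j + 1)) ω') →
        -- measurability of the residual serving `s′`
        (∀ j (Y : Set (Site (F.P p.K) 0)), Measurable ((θ.zhAt p s).ζ0 j Y)) →
        (∀ j (Λ' : Set (Site (F.P p.K) 0)), Measurable ((θ.zhAt p s).quad j Λ')) →
        -- per old branch: A-fibre domination (K0b)
        (∀ S ∈ admSOfRecord F θ.ν θ.τ9.M (gOfRecord₁₃ F N θ.toStage13Params p) p.K k s.init, ∀ j : ℕ,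
          ∃ ŵ : (↥(Set.toFinite (B10Eq42TorusConstraint.bondsIn j ((s.init.Λ (j + 1))ᶜ ∩ s.init.Ω (j + 1)))).toFinset → FluctV N) → ℝ≥0∞, Measurable ŵ ∧
            (∫⁻ a, ŵ a ∂(Measure.pi fun _ : ↥(Set.toFinite (B10Eq42TorusConstraint.bondsIn j ((s.init.Λ (j + 1))ᶜ ∩ s.init.Ω (j + 1)))).toFinset => (volume : Measure (FluctV N)))) ≠ ⊤ ∧
            ∀ ω, ENNReal.ofReal ((WtOfRecord₁₃H F N θ p s).w j (s.init.Λ (j + 1)) ((s.init.Λ (j + 1))ᶜ ∩ s.init.Ω (j + 1)) (S (j + 1)) ω) ≤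
              ŵ (fun b : ↥(Set.toFinite (B10Eq42TorusConstraint.bondsIn j ((s.init.Λ (j + 1))ᶜ ∩ s.init.Ω (j + 1)))).toFinset => (ω j).2 b)) →
        -- def-T: the 𝐁-terms of the witness at the parent history, READ AT THE EMBEDDED BACKGROUND, are JOINTLY measurable in `(U, A)` (LOCATED residue)
        (∀ (S' : ℕ → Set (Site (F.P p.K) 0)) (j : ℕ) (X : (Sect2.domSys (F.P p.K) θ.τ9.M j).Dom),
          Measurable (fun q : GaugeField (F.P p.K) 0 (SU N) × MSFluct (F.P p.K) (FluctV N) =>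
            ((t s.init).B j X (Sect2.ofBackgroundC (settingOfRecord₁₃ F N θ.toStage13Params p).ι q.1) (S', q.2)).re)) →
        (slotsTOfRecord F N θ.ν θ.τ9 (EOfRecord₁₃ F N θ.toStage13Params) (wOfRecord₉ F N θ.toStage9Params) θ.ppSel p
            (gOfRecord₁₃ F N θ.toStage13Params p) (k + 1) s = 0 ∨
          ∀ᵐ V' ∂fieldMeasure (F.P p.K) (k + 1) (SU N),
            chiSeqOfRecord F N θ.ν θ.τ9.M (gOfRecord₁₃ F N θ.toStage13Params p) p.K (k + 1) s V' ≠ 0 →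
              slotsTOfRecord F N θ.ν θ.τ9 (EOfRecord₁₃ F N θ.toStage13Params) (wOfRecord₉ F N θ.toStage9Params) θ.ppSel p
                  (gOfRecord₁₃ F N θ.toStage13Params p) (k + 1) s V' =
                sect2Slot F N (FluctV N) p.K (settingOfRecord₁₃ F N θ.toStage13Params p) (θ.rzAt p s) (WtOfRecord₁₃H F N θ p s) s
                  (t s.init) (Ek s.init) (UbgOfRecord₁₃CoP F N θ.toStage13Params p (k + 1) s) V') := by
  obtain ⟨t, Ek, hform, hloc⟩ := (sLaw₁₃CoPH_iff_exists_local θ p k).1 hS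
  -- the run's window: couplings `g_{j−1} ∈ [0, γ]`, positive radii, the vacuum in every `U^c_j(X)`
  have hg : ∀ j, 1 ≤ j → j ≤ k → 0 ≤ (settingOfRecord₁₃ F N θ.toStage13Params p).flow.g (j - 1) ∧
      (settingOfRecord₁₃ F N θ.toStage13Params p).flow.g (j - 1) ≤ (settingOfRecord₁₃ F N θ.toStage13Params p).lf.γ :=
    fun j _ hj => ⟨(hw (j - 1) (by omega)).1.le, (hw (j - 1) (by omega)).2⟩
  have h1 : ∀ (s₀ : SeqOfRecord F θ.ν θ.τ9.M (gOfRecord₁₃ F N θ.toStage13Params p) p.K k) (j : ℕ), 1 ≤ j → j ≤ k →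
      ∀ X : (Sect2.domSys (F.P p.K) θ.τ9.M j).Dom,
      Sect2.ofBackgroundC (settingOfRecord₁₃ F N θ.toStage13Params p).ι (1 : GaugeField (F.P p.K) 0 (SU N)) ∈
        Sect2.spaceI (settingOfRecord₁₃ F N θ.toStage13Params p) (θ.rzAt p s₀) θ.τ9.M j (Sect2.domSites (F.P p.K) θ.τ9.M j X)
          ((settingOfRecord₁₃ F N θ.toStage13Params p).lf.alpha0 ((settingOfRecord₁₃ F N θ.toStage13Params p).flow.g j))
          ((settingOfRecord₁₃ F N θ.toStage13Params p).lf.alpha1 ((settingOfRecord₁₃ F N θ.toStage13Params p).flow.g j)) :=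
    fun s₀ j _ hj X => Sect2.one_mem_spaceI _ (settingOfRecord₁₃_pos F N θ.toStage13Params hpos p).cB_pos (h.rzAtLaws p s₀) θ.τ9.M j _
      (alphaPos₁₃_of_inInterval hθ hw hj).1 (alphaPos₁₃_of_inInterval hθ hw hj).2
  have hformT := hasSect2FormAtZS_spaceTrunc_of_charged (settingOfRecord₁₃ F N θ.toStage13Params p) (le_refl k) (θ.rzAt p) (WtOfRecord₁₃H F N θ p)
    (UbgOfRecord₁₃CoP F N θ.toStage13Params p k) _
    (fun s₀ j U₀ => PlaqSmallOn (plaqsOf (pts j (Γr s₀ j (s₀.Ω (j + 1))ᶜ))) (cR * epsOfRecord θ.ν (gOfRecord₁₃ F N θ.toStage13Params p) j) U₀)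
    (fun s₀ j _ ω hz => plaqSmallOn_readOn_of_zetaP_ne_zero (hreg s₀) s₀.Ω j hz) hg h1
    (fun s₀ hs Wc hχ hR j h1j hjk X => hbg s₀ Wc ⟨hs, hχ, hR⟩ j h1j hjk X) hform
  refine ⟨fun s₀ => spaceTrunc (settingOfRecord₁₃ F N θ.toStage13Params p) k (t s₀), Ek, hformT,
    fun s₀ => isFluctLocal_spaceTrunc (hloc s₀) _ k, fun s hΩ hpre hZ hq hqloc hζm hqm hW hB => ?_⟩
  refine clause_succ_CoPH_of_Omega_empty_of_pinChi_of_oldBranch_of_clause_of_graph θ p h hk hM s hΩ hqloc hpre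
    (spaceTrunc (settingOfRecord₁₃ F N θ.toStage13Params p) k (t s.init)) (Ek s.init)
    (fun S a a' Uf ha => action23_sect2ActionDataOfRecord_congr_fluct_of_isFluctLocal p.K _ _ s.init (isFluctLocal_spaceTrunc (hloc s.init) _ k)
      (Ek s.init) S a a' ha Uf)
    (hformT.2 s.init).2 hZ hq fun S hSm => ?_
  choose ŵ hŵm hŵfin hdom using hW S hSm
  haveI : BorelSpace (GaugeField (F.P p.K) 0 (SU N)) := inferInstanceAs (BorelSpace (PBond (F.P p.K) 0 → SU N))
  have hcont : Continuous fun U : GaugeField (F.P p.K) 0 (SU N) => Sect2.ofBackgroundC (settingOfRecord₁₃ F N θ.toStage13Params p).ι U :=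
    continuous_ofBackgroundC_ιSU
  have hΦm := measurable_sect2Operand_of_termRows p.K (settingOfRecord₁₃ F N θ.toStage13Params p) (θ.rzAt p s.init) s.init
    (spaceTrunc (settingOfRecord₁₃ F N θ.toStage13Params p) k (t s.init)) (Ek s.init) (measurable_UbgOfRecord₁₃CoP F N θ.toStage13Params p k s.init) S
    (fun j X z g' => measurable_re_spaceTrunc_E_comp _ k (t s.init) hcont j X z g')
    (fun j X => measurable_re_spaceTrunc_R_comp _ k (t s.init) hcont j X) (hB S)
  obtain ⟨CE, hCE⟩ := exists_bound_spaceTrunc_E (settingOfRecord₁₃ F N θ.toStage13Params p) k (t s.init)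
  obtain ⟨CR, hCR⟩ := exists_bound_spaceTrunc_R (settingOfRecord₁₃ F N θ.toStage13Params p) k (t s.init)
  obtain ⟨CB, hCB⟩ := exists_bound_spaceTrunc_B (settingOfRecord₁₃ F N θ.toStage13Params p) k (t s.init)
  obtain ⟨CΦ, hΦle⟩ := exists_bound_sect2Operand_of_termBounds p.K (settingOfRecord₁₃ F N θ.toStage13Params p) (θ.rzAt p s.init) s.init
    (spaceTrunc (settingOfRecord₁₃ F N θ.toStage13Params p) k (t s.init)) (Ek s.init) (UbgOfRecord₁₃CoP F N θ.toStage13Params p k s.init)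
    ⟨CE, fun j X z g' U => hCE j X z g' _⟩ ⟨CR, fun j X U => hCR j X _⟩ ⟨CB, fun j X U a => hCB j X _ a⟩
  exact integrable_oldBranch_of_dominated θ p h.zhLaws hU s S hζm hqm ŵ hŵm
    (fun j => (∫⁻ a, ŵ j a ∂(Measure.pi fun _ : ↥(Set.toFinite (B10Eq42TorusConstraint.bondsIn j ((s.init.Λ (j + 1))ᶜ ∩ s.init.Ω (j + 1)))).toFinset => (volume : Measure (FluctV N)))).toNNReal)
    (fun j => le_of_eq (ENNReal.coe_toNNReal (hŵfin j)).symm) hdom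
    (Φ := sect2Operand F N (FluctV N) p.K (settingOfRecord₁₃ F N θ.toStage13Params p) (θ.rzAt p s.init) s.init
      (spaceTrunc (settingOfRecord₁₃ F N θ.toStage13Params p) k (t s.init)) (Ek s.init) (UbgOfRecord₁₃CoP F N θ.toStage13Params p k s.init))
    hΦm (fun a U => (sect2Operand_pos p.K _ _ s.init _ (Ek s.init) _ a U).le) CΦ hΦle

/-- **★★★★ p591695's WITNESS-FIRST FACE WITH THE BACKGROUND PROVISO READ AT CHARGED INDICES ONLY.**  As
`…SpaceTruncationBorelB.exists_local_witness_clause_succ_of_hasSect2FormAtZS_of_borelB_of_bgRead` (a NAMED §2 witness `(t₀, E₀)` whose 𝐁-terms are Borel along the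
embedding, `hBt`; NO row on the witness), conclusion VERBATIM, with def-R's `BgProvisoΛ` asked over the CHARGED reading support only.
[cite: Balaban1988Convergent, Theorem p.245, Thm 1 p.262, (2.7) p.255, (2.10) p.256, (2.18) p.257, (2.20)–(2.28) pp.258–259, (2.31) p.260, (2.41)–(2.42) p.261, (3.24)–(3.25) p.270; Balaban1989LargeFieldI, (0.2)–(0.3) p.176; Balaban1987RG1, Thm 3 p.264] -/
theorem exists_local_witness_clause_succ_of_hasSect2FormAtZS_of_borelB_of_bgReadCharged (h : θ.Provisos₁₃CoPH F N) (hU : θ.ZhUnity F N)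
    (hθ : θ.Admissible F N) (hpos : θ.s2.Pos) {k : ℕ} (hk : k < p.K) (hM : 1 ≤ θ.τ9.M) (hw : Step.InInterval θ.γ k (gOfRecord₁₃ F N θ.toStage13Params p))
    (cR : ℝ) (Γr : SeqOfRecord F θ.ν θ.τ9.M (gOfRecord₁₃ F N θ.toStage13Params p) p.K k → ℕ → Set (Site (F.P p.K) 0) → Set (Site (F.P p.K) 0))
    (hreg : ∀ s₀, (θ.zhAt p s₀).RegOn F N (FluctV N) θ.ν cR p (gOfRecord₁₃ F N θ.toStage13Params p) (Γr s₀))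
    (hbg : BgProvisoΛ F N p.K (settingOfRecord₁₃ F N θ.toStage13Params p) (θ.Rz p.K) θ.τ9.M k
      (fun s₀ => {Wc | slotsOfRecord F N θ.ν θ.τ9 (EOfRecord₁₃ F N θ.toStage13Params) (wOfRecord₉ F N θ.toStage9Params) θ.ppSel p
          (gOfRecord₁₃ F N θ.toStage13Params p) k s₀ ≠ 0 ∧
        chiSeqOfRecord F N θ.ν θ.τ9.M (gOfRecord₁₃ F N θ.toStage13Params p) p.K k s₀ (Wc k) ≠ 0 ∧
        ∀ j, j < k → PlaqSmallOn (plaqsOf (pts j (Γr s₀ j (s₀.Ω (j + 1))ᶜ))) (cR * epsOfRecord θ.ν (gOfRecord₁₃ F N θ.toStage13Params p) j) (Wc j)})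
      (UbgOfRecord₁₃CoP F N θ.toStage13Params p k))
    (t₀ : SeqOfRecord F θ.ν θ.τ9.M (gOfRecord₁₃ F N θ.toStage13Params p) p.K k → Sect2.TermValues (F.P p.K) (MatA N) (FluctV N) θ.τ9.M)
    (E₀ : SeqOfRecord F θ.ν θ.τ9.M (gOfRecord₁₃ F N θ.toStage13Params p) p.K k → ℝ)
    (hform₀ : HasSect2FormAtZS F N (FluctV N) p.K (settingOfRecord₁₃ F N θ.toStage13Params p) k (θ.rzAt p) (WtOfRecord₁₃H F N θ p)
      (UbgOfRecord₁₃CoP F N θ.toStage13Params p k)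
      (fun s₀ t' => Sect2.LawsRT (sect2TowerOfRecord F N (FluctV N) p.K (settingOfRecord₁₃ F N θ.toStage13Params p) (θ.rzAt p s₀) s₀ t')
        (settingOfRecord₁₃ F N θ.toStage13Params p).lf k)
      (slotsOfRecord F N θ.ν θ.τ9 (EOfRecord₁₃ F N θ.toStage13Params) (wOfRecord₉ F N θ.toStage9Params) θ.ppSel p (gOfRecord₁₃ F N θ.toStage13Params p) k) t₀ E₀)
    (hBt : ∀ s₀ (S' : ℕ → Set (Site (F.P p.K) 0)) (j : ℕ) (X : (Sect2.domSys (F.P p.K) θ.τ9.M j).Dom),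
      Measurable (fun q : GaugeField (F.P p.K) 0 (SU N) × MSFluct (F.P p.K) (FluctV N) =>
        (t₀ s₀).B j X (Sect2.ofBackgroundC (settingOfRecord₁₃ F N θ.toStage13Params p).ι q.1) (S', q.2))) :
    ∃ (t : SeqOfRecord F θ.ν θ.τ9.M (gOfRecord₁₃ F N θ.toStage13Params p) p.K k → Sect2.TermValues (F.P p.K) (MatA N) (FluctV N) θ.τ9.M)
      (Ek : SeqOfRecord F θ.ν θ.τ9.M (gOfRecord₁₃ F N θ.toStage13Params p) p.K k → ℝ),
      HasSect2FormAtZS F N (FluctV N) p.K (settingOfRecord₁₃ F N θ.toStage13Params p) k (θ.rzAt p) (WtOfRecord₁₃H F N θ p)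
          (UbgOfRecord₁₃CoP F N θ.toStage13Params p k)
          (fun s₀ t₀ => Sect2.LawsRT (sect2TowerOfRecord F N (FluctV N) p.K (settingOfRecord₁₃ F N θ.toStage13Params p) (θ.rzAt p s₀) s₀ t₀)
            (settingOfRecord₁₃ F N θ.toStage13Params p).lf k)
          (slotsOfRecord F N θ.ν θ.τ9 (EOfRecord₁₃ F N θ.toStage13Params) (wOfRecord₉ F N θ.toStage9Params) θ.ppSel p
            (gOfRecord₁₃ F N θ.toStage13Params p) k) t Ek ∧
      (∀ s₀, IsFluctLocal k (t s₀)) ∧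
      ∀ (s : SeqOfRecord F θ.ν θ.τ9.M (gOfRecord₁₃ F N θ.toStage13Params p) p.K (k + 1)), s.Ω (k + 1) = ∅ →
        -- (P) prefix agreement below `k`
        (∀ j, j < k → (θ.zhAt p s).ζ0 j = (θ.zhAt p s.init).ζ0 j ∧ (θ.zhAt p s).quad j = (θ.zhAt p s.init).quad j) →
        -- (V) the generation-`k` pin with the old front factor
        (∀ (V' : GaugeField (F.P p.K) (k + 1) (SU N)) (U₀ : GaugeField (F.P p.K) k (SU N)),
          (θ.zhAt p s).ζ0 k Set.univ (pairCfgAt (V := FluctV N) k V' U₀) =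
            chiSeqOfRecord F N θ.ν θ.τ9.M (gOfRecord₁₃ F N θ.toStage13Params p) p.K k s.init U₀ *
              wOfRecord₉ F N θ.toStage9Params p (gOfRecord₁₃ F N θ.toStage13Params p) k s U₀ ((avOfRecord F N p.K k).avg U₀)) →
        -- `quad_k(∅) = 0` on the two-scale configurations
        (∀ (V' : GaugeField (F.P p.K) (k + 1) (SU N)) (U₀ : GaugeField (F.P p.K) k (SU N)), (θ.zhAt p s).quad k ∅ (pairCfgAt (V := FluctV N) k V' U₀) = 0) →
        -- `k`-locality of `quad_j(Λ_{j+1})`, `j < k`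
        (∀ j, j < k → ∀ ω ω' : MultiCfg (F.P p.K) (SU N) (FluctV N), (∀ i, i ≤ k → ω i = ω' i) →
          (θ.zhAt p s).quad j (s.init.Λ (j + 1)) ω = (θ.zhAt p s).quad j (s.init.Λ (j + 1)) ω') →
        -- measurability of the residual serving `s′`
        (∀ j (Y : Set (Site (F.P p.K) 0)), Measurable ((θ.zhAt p s).ζ0 j Y)) →
        (∀ j (Λ' : Set (Site (F.P p.K) 0)), Measurable ((θ.zhAt p s).quad j Λ')) →
        -- per old branch: A-fibre domination (K0b)
        (∀ S ∈ admSOfRecord F θ.ν θ.τ9.M (gOfRecord₁₃ F N θ.toStage13Params p) p.K k s.init, ∀ j : ℕ,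
          ∃ ŵ : (↥(Set.toFinite (B10Eq42TorusConstraint.bondsIn j ((s.init.Λ (j + 1))ᶜ ∩ s.init.Ω (j + 1)))).toFinset → FluctV N) → ℝ≥0∞, Measurable ŵ ∧
            (∫⁻ a, ŵ a ∂(Measure.pi fun _ : ↥(Set.toFinite (B10Eq42TorusConstraint.bondsIn j ((s.init.Λ (j + 1))ᶜ ∩ s.init.Ω (j + 1)))).toFinset => (volume : Measure (FluctV N)))) ≠ ⊤ ∧
            ∀ ω, ENNReal.ofReal ((WtOfRecord₁₃H F N θ p s).w j (s.init.Λ (j + 1)) ((s.init.Λ (j + 1))ᶜ ∩ s.init.Ω (j + 1)) (S (j + 1)) ω) ≤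
              ŵ (fun b : ↥(Set.toFinite (B10Eq42TorusConstraint.bondsIn j ((s.init.Λ (j + 1))ᶜ ∩ s.init.Ω (j + 1)))).toFinset => (ω j).2 b)) →
        (slotsTOfRecord F N θ.ν θ.τ9 (EOfRecord₁₃ F N θ.toStage13Params) (wOfRecord₉ F N θ.toStage9Params) θ.ppSel p
            (gOfRecord₁₃ F N θ.toStage13Params p) (k + 1) s = 0 ∨
          ∀ᵐ V' ∂fieldMeasure (F.P p.K) (k + 1) (SU N),
            chiSeqOfRecord F N θ.ν θ.τ9.M (gOfRecord₁₃ F N θ.toStage13Params p) p.K (k + 1) s V' ≠ 0 →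
              slotsTOfRecord F N θ.ν θ.τ9 (EOfRecord₁₃ F N θ.toStage13Params) (wOfRecord₉ F N θ.toStage9Params) θ.ppSel p
                  (gOfRecord₁₃ F N θ.toStage13Params p) (k + 1) s V' =
                sect2Slot F N (FluctV N) p.K (settingOfRecord₁₃ F N θ.toStage13Params p) (θ.rzAt p s) (WtOfRecord₁₃H F N θ p s) s
                  (t s.init) (Ek s.init) (UbgOfRecord₁₃CoP F N θ.toStage13Params p (k + 1) s) V') := by
  -- g10's fluctuation truncation at level `k`, then the space truncation with retracted boundary terms, the background read at charged indices only
  have hform₁ := hasSect2FormAtZS_truncTermValues (settingOfRecord₁₃ F N θ.toStage13Params p) (Nat.le_succ k) (θ.rzAt p) (WtOfRecord₁₃H F N θ p)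
    (UbgOfRecord₁₃CoP F N θ.toStage13Params p k) _ _
    (fun s₀ t' ht' => lawsRT_truncTermValues (settingOfRecord₁₃ F N θ.toStage13Params p) (θ.rzAt p s₀) s₀.Ω t' _ k k ht') hform₀
  have hg : ∀ j, 1 ≤ j → j ≤ k → 0 ≤ (settingOfRecord₁₃ F N θ.toStage13Params p).flow.g (j - 1) ∧
      (settingOfRecord₁₃ F N θ.toStage13Params p).flow.g (j - 1) ≤ (settingOfRecord₁₃ F N θ.toStage13Params p).lf.γ :=
    fun j _ hj => ⟨(hw (j - 1) (by omega)).1.le, (hw (j - 1) (by omega)).2⟩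
  have h1 : ∀ (s₀ : SeqOfRecord F θ.ν θ.τ9.M (gOfRecord₁₃ F N θ.toStage13Params p) p.K k) (j : ℕ), 1 ≤ j → j ≤ k →
      ∀ X : (Sect2.domSys (F.P p.K) θ.τ9.M j).Dom,
      Sect2.ofBackgroundC (settingOfRecord₁₃ F N θ.toStage13Params p).ι (1 : GaugeField (F.P p.K) 0 (SU N)) ∈
        Sect2.spaceI (settingOfRecord₁₃ F N θ.toStage13Params p) (θ.rzAt p s₀) θ.τ9.M j (Sect2.domSites (F.P p.K) θ.τ9.M j X)
          ((settingOfRecord₁₃ F N θ.toStage13Params p).lf.alpha0 ((settingOfRecord₁₃ F N θ.toStage13Params p).flow.g j))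
          ((settingOfRecord₁₃ F N θ.toStage13Params p).lf.alpha1 ((settingOfRecord₁₃ F N θ.toStage13Params p).flow.g j)) :=
    fun s₀ j _ hj X => Sect2.one_mem_spaceI _ (settingOfRecord₁₃_pos F N θ.toStage13Params hpos p).cB_pos (h.rzAtLaws p s₀) θ.τ9.M j _
      (alphaPos₁₃_of_inInterval hθ hw hj).1 (alphaPos₁₃_of_inInterval hθ hw hj).2
  have hformT := hasSect2FormAtZS_spaceTruncR_of_charged (settingOfRecord₁₃ F N θ.toStage13Params p) (le_refl k) (θ.rzAt p) (WtOfRecord₁₃H F N θ p)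
    (UbgOfRecord₁₃CoP F N θ.toStage13Params p k) _
    (fun s₀ j U₀ => PlaqSmallOn (plaqsOf (pts j (Γr s₀ j (s₀.Ω (j + 1))ᶜ))) (cR * epsOfRecord θ.ν (gOfRecord₁₃ F N θ.toStage13Params p) j) U₀)
    (fun s₀ j _ ω hz => plaqSmallOn_readOn_of_zetaP_ne_zero (hreg s₀) s₀.Ω j hz) hg h1
    (fun s₀ hs Wc hχ hR j h1j hjk X => hbg s₀ Wc ⟨hs, hχ, hR⟩ j h1j hjk X) hform₁
  refine ⟨fun s₀ => spaceTruncR (settingOfRecord₁₃ F N θ.toStage13Params p) k (truncTermValues k (t₀ s₀)), E₀, hformT,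
    fun s₀ => isFluctLocal_spaceTruncR (isFluctLocal_truncTermValues k (t₀ s₀)) _ k, fun s hΩ hpre hZ hq hqloc hζm hqm hW => ?_⟩
  refine clause_succ_CoPH_of_Omega_empty_of_pinChi_of_oldBranch_of_clause_of_graph θ p h hk hM s hΩ hqloc hpre
    (spaceTruncR (settingOfRecord₁₃ F N θ.toStage13Params p) k (truncTermValues k (t₀ s.init))) (E₀ s.init)
    (fun S a a' Uf ha => action23_sect2ActionDataOfRecord_congr_fluct_of_isFluctLocal p.K _ _ s.init
      (isFluctLocal_spaceTruncR (isFluctLocal_truncTermValues k (t₀ s.init)) _ k) (E₀ s.init) S a a' ha Uf)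
    (hformT.2 s.init).2 hZ hq fun S hSm => ?_
  choose ŵ hŵm hŵfin hdom using hW S hSm
  haveI : BorelSpace (GaugeField (F.P p.K) 0 (SU N)) := inferInstanceAs (BorelSpace (PBond (F.P p.K) 0 → SU N))
  have hcont : Continuous fun U : GaugeField (F.P p.K) 0 (SU N) => Sect2.ofBackgroundC (settingOfRecord₁₃ F N θ.toStage13Params p).ι U :=
    continuous_ofBackgroundC_ιSU
  have hΦm := measurable_sect2Operand_of_termRows p.K (settingOfRecord₁₃ F N θ.toStage13Params p) (θ.rzAt p s.init) s.init
    (spaceTruncR (settingOfRecord₁₃ F N θ.toStage13Params p) k (truncTermValues k (t₀ s.init))) (E₀ s.init)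
    (measurable_UbgOfRecord₁₃CoP F N θ.toStage13Params p k s.init) S
    (fun j X z g' => measurable_re_spaceTrunc_E_comp _ k (truncTermValues k (t₀ s.init)) hcont j X z g')
    (fun j X => measurable_re_spaceTrunc_R_comp _ k (truncTermValues k (t₀ s.init)) hcont j X)
    (fun j X => measurable_re_spaceTruncR_B_comp_of_borel _ k (truncTermValues k (t₀ s.init)) j X (fl := fun a : MSFluct (F.P p.K) (FluctV N) => (S, a))
      (measurable_B_truncTermValues_of_borel (t₀ s.init) k j X S (hBt s.init S j X)))
  obtain ⟨CE, hCE⟩ := exists_bound_spaceTrunc_E (settingOfRecord₁₃ F N θ.toStage13Params p) k (truncTermValues k (t₀ s.init))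
  obtain ⟨CR, hCR⟩ := exists_bound_spaceTrunc_R (settingOfRecord₁₃ F N θ.toStage13Params p) k (truncTermValues k (t₀ s.init))
  obtain ⟨CB, hCB⟩ := exists_bound_spaceTruncR_B (settingOfRecord₁₃ F N θ.toStage13Params p) k (truncTermValues k (t₀ s.init))
  obtain ⟨CΦ, hΦle⟩ := exists_bound_sect2Operand_of_termBounds p.K (settingOfRecord₁₃ F N θ.toStage13Params p) (θ.rzAt p s.init) s.init
    (spaceTruncR (settingOfRecord₁₃ F N θ.toStage13Params p) k (truncTermValues k (t₀ s.init))) (E₀ s.init) (UbgOfRecord₁₃CoP F N θ.toStage13Params p k s.init)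
    ⟨CE, fun j X z g' U => hCE j X z g' _⟩ ⟨CR, fun j X U => hCR j X _⟩ ⟨CB, fun j X U a => hCB j X _ a⟩
  exact integrable_oldBranch_of_dominated θ p h.zhLaws hU s S hζm hqm ŵ hŵm
    (fun j => (∫⁻ a, ŵ j a ∂(Measure.pi fun _ : ↥(Set.toFinite (B10Eq42TorusConstraint.bondsIn j ((s.init.Λ (j + 1))ᶜ ∩ s.init.Ω (j + 1)))).toFinset => (volume : Measure (FluctV N)))).toNNReal)
    (fun j => le_of_eq (ENNReal.coe_toNNReal (hŵfin j)).symm) hdom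
    (Φ := sect2Operand F N (FluctV N) p.K (settingOfRecord₁₃ F N θ.toStage13Params p) (θ.rzAt p s.init) s.init
      (spaceTruncR (settingOfRecord₁₃ F N θ.toStage13Params p) k (truncTermValues k (t₀ s.init))) (E₀ s.init) (UbgOfRecord₁₃CoP F N θ.toStage13Params p k s.init))
    hΦm (fun a U => (sect2Operand_pos p.K _ _ s.init _ (E₀ s.init) _ a U).le) CΦ hΦle

end Record

end Summit.QuantumFields.YangMills.Theorems.BalabanUVNodesN11SpaceTruncationCharged

end
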